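/-
Copyright: derived here (Resolution Observatory cell `pub-rosobs`, carver gen 50). AI-written Lean; AI review is
weaker than expert review.  Companion file of the cell's POLYNOMIAL weighted-centre model `W(f)`: the elementary
identity core of engine 1's STEP 5♯ / LEMMA D⁺ bookkeeping (CARVER-NOTES-eng1-g34 T13, "second-class gap").
Instrument — NOT a resolution theorem and NOT a statement about the invariant of [AbramovichTemkinWlodarczyk2024].
-/
import Mathlib.RingTheory.MvPolynomial.WeightedHomogeneous
import Mathlib.Tactic.Linarith
import Mathlib.Tactic.FieldSimp
import HarnessLib

/-!
# The second-class gap: a weighted-homogeneous polynomial whose weight lies below every variable weight vanishes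

Two elementary facts used by the cell's engine 1 (THEOREM-FQ-eng1-g34, STEP 5♯ and LEMMA D⁺; CARVER-NOTES T13), typed
once so that the engine can cite them by name:

* `isWeightedHomogeneous_eq_zero_of_weight_lt` — over any commutative semiring and any ordered additive monoid of
  weights: if `φ` is weighted homogeneous of weight `κ` with `0 < κ` and `κ < w i` for EVERY variable `i`, then `φ = 0`
  (a monomial of positive weight contains a variable, whose weight is at most the monomial's weight);
  `coeff_eq_zero_of_weight_lt` is the coefficientwise form and `weightedHomogeneousComponent_eq_zero_of_weight_lt`
  the component form (no homogeneity hypothesis).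
* `secondClass_gap` — in a linearly ordered field: `1 < (p + 1)·w` and `p·w < 1` imply `0 < 1 - p·w < w`
  (`one_div` form: `1/(p+1) < w < 1/p`); so (`secondClass_eq_zero`) a weighted-homogeneous polynomial of weight
  `1 - p·w` in variables of weights `≥ w` is zero.  In the model: a slot of weight `w ∈ (1/(p+1), 1/p)` leaves the
  residual weight `1 - p·w` of the `p`-th power class strictly between `0` and the least variable weight, so the
  corresponding quasi-homogeneous cofactor vanishes.

[ATW24] Abramovich–Temkin–Włodarczyk, *Functorial embedded resolution via weighted blowings up*, Algebra & Number
Theory 18 (2024), §5.1 (p. 1575: the invariant `(a_1, …, a_k)` and the weights of the centre).  CONTEXT ONLY: the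
statements below are elementary and ours; Mathlib's `MvPolynomial.IsWeightedHomogeneous` / `Finsupp.weight` are used
as they are.
-/

namespace Literature.AlgebraicGeometry.Resolution.WeightedBlowup

open MvPolynomial Finsupp

section Weights

variable {σ R M : Type*} [CommSemiring R] [AddCommMonoid M] [PartialOrder M] [IsOrderedAddMonoid M]
  {w : σ → M} {κ : M}

/-- A monomial of positive weight below every variable weight does not exist: if `0 < κ` and `κ < w i` for all `i`,
no exponent vector has `w`-weight `κ` (elementary; ours).
[cite: AbramovichTemkinWlodarczyk2024, §5.1 (p. 1575)] -/
theorem weight_ne_of_weight_lt (hκ : 0 < κ) (hw : ∀ i, κ < w i) (d : σ →₀ ℕ) : weight w d ≠ κ := by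
  intro hd
  by_cases h0 : d = 0
  · subst h0
    simp only [map_zero] at hd
    exact (ne_of_lt hκ) hd
  · obtain ⟨s, hs⟩ : ∃ s, d s ≠ 0 := by
      by_contra h
      exact h0 (Finsupp.ext fun i => by simpa using not_exists.mp h i)
    have hle : w s ≤ weight w d :=
      le_weight_of_ne_zero (fun i => le_of_lt (lt_trans hκ (hw i))) hs
    exact (lt_irrefl κ) (lt_of_lt_of_le (hw s) (hd ▸ hle))

/-- Coefficientwise form: for ANY polynomial `φ`, the coefficient of a monomial of weight `κ` vanishes when
`0 < κ < w i` for all `i` — because there is no such monomial (elementary; ours).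
[cite: AbramovichTemkinWlodarczyk2024, §5.1 (p. 1575)] -/
theorem coeff_eq_zero_of_weight_lt (hκ : 0 < κ) (hw : ∀ i, κ < w i) (φ : MvPolynomial σ R) (d : σ →₀ ℕ)
    (hd : weight w d = κ) : φ.coeff d = 0 :=
  absurd hd (weight_ne_of_weight_lt hκ hw d)

/-- **Second-class gap, monomial lemma** (CARVER-NOTES-eng1-g34 T13; elementary, ours): a weighted-homogeneous
polynomial of weight `κ` with `0 < κ < w i` for every variable `i` is zero.
[cite: AbramovichTemkinWlodarczyk2024, §5.1 (p. 1575)] -/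
theorem isWeightedHomogeneous_eq_zero_of_weight_lt {φ : MvPolynomial σ R} (hφ : φ.IsWeightedHomogeneous w κ)
    (hκ : 0 < κ) (hw : ∀ i, κ < w i) : φ = 0 := by
  ext d
  rw [coeff_zero]
  by_contra hd
  exact weight_ne_of_weight_lt hκ hw d (hφ hd)

/-- Component form: the weight-`κ` homogeneous component of ANY polynomial vanishes when `0 < κ < w i` for all `i`
(elementary; ours). [cite: AbramovichTemkinWlodarczyk2024, §5.1 (p. 1575)] -/
theorem weightedHomogeneousComponent_eq_zero_of_weight_lt (hκ : 0 < κ) (hw : ∀ i, κ < w i)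
    (φ : MvPolynomial σ R) : weightedHomogeneousComponent w κ φ = 0 :=
  isWeightedHomogeneous_eq_zero_of_weight_lt
    (weightedHomogeneousComponent_isWeightedHomogeneous (w := w) (n := κ) (φ := φ)) hκ hw

/-- The only weighted-homogeneous polynomials of weight below every variable weight are the constants: weight `0`
or zero (elementary; ours — the dichotomy used when a cofactor's weight is forced below the lightest slot).
[cite: AbramovichTemkinWlodarczyk2024, §5.1 (p. 1575)] -/
theorem isWeightedHomogeneous_eq_zero_or_weight_eq_zero {φ : MvPolynomial σ R}
    (hφ : φ.IsWeightedHomogeneous w κ) (h0 : 0 ≤ κ) (hw : ∀ i, κ < w i) : φ = 0 ∨ κ = 0 := by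
  rcases eq_or_lt_of_le h0 with h | h
  · exact Or.inr h.symm
  · exact Or.inl (isWeightedHomogeneous_eq_zero_of_weight_lt hφ h hw)

end Weights

section Gap

variable {K : Type*} [Field K] [LinearOrder K] [IsStrictOrderedRing K]

/-- **Second-class gap, arithmetic** (CARVER-NOTES-eng1-g34 T13; elementary, ours): `1 < (p+1)·w` and `p·w < 1`
imply `0 < 1 - p·w` and `1 - p·w < w`. [cite: AbramovichTemkinWlodarczyk2024, §5.1 (p. 1575)] -/
theorem secondClass_gap {p w : K} (h₁ : 1 < (p + 1) * w) (h₂ : p * w < 1) :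
    0 < 1 - p * w ∧ 1 - p * w < w := by
  constructor <;> nlinarith

/-- The same with the hypotheses as `1/(p+1) < w < 1/p` for a positive natural `p` (elementary; ours).
[cite: AbramovichTemkinWlodarczyk2024, §5.1 (p. 1575)] -/
theorem secondClass_gap_of_one_div {p : ℕ} (hp : 0 < p) {w : K} (h₁ : 1 / ((p : K) + 1) < w)
    (h₂ : w < 1 / (p : K)) : 0 < 1 - (p : K) * w ∧ 1 - (p : K) * w < w := by
  have hp' : (0 : K) < p := by exact_mod_cast hp
  have hp1 : (0 : K) < (p : K) + 1 := by linarith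
  refine secondClass_gap ?_ ?_
  · have := (div_lt_iff₀ hp1).1 h₁
    linarith
  · have := (lt_div_iff₀ hp').1 h₂
    linarith

/-- **Second-class vanishing** (CARVER-NOTES-eng1-g34 T13; elementary, ours): with weights in a linearly ordered
field, if every variable weighs at least `w`, `1 < (p+1)·w`, `p·w < 1`, and `φ` is weighted homogeneous of weight
`1 - p·w`, then `φ = 0`. [cite: AbramovichTemkinWlodarczyk2024, §5.1 (p. 1575)] -/
theorem secondClass_eq_zero {σ R : Type*} [CommSemiring R] {wt : σ → K} {p w : K} (hmin : ∀ i, w ≤ wt i)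
    (h₁ : 1 < (p + 1) * w) (h₂ : p * w < 1) {φ : MvPolynomial σ R}
    (hφ : φ.IsWeightedHomogeneous wt (1 - p * w)) : φ = 0 :=
  isWeightedHomogeneous_eq_zero_of_weight_lt hφ (secondClass_gap h₁ h₂).1
    (fun i => lt_of_lt_of_le (secondClass_gap h₁ h₂).2 (hmin i))

end Gap

end Literature.AlgebraicGeometry.Resolution.WeightedBlowup
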